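import Literature.Topology.FourManifolds.BandSumJunctionCoords
import Mathlib.Analysis.Calculus.Deriv.Inverse
import HarnessLib

/-!
# Matching two parametrisations near the ends of a window (one-variable calculus)

Topic `Literature/Topology/FourManifolds`. Calculus lemmas for the fact seat
`provefact-Literature.Topology.FourManifolds.BandData.exists_ambientIsotopy_of_band_eq_of_isRegular`
(`BandSumIsotopyRegular.lean`): when two band sums `K`, `K'` along the same band are compared, the
lower arc of `K'` has to be re-parametrised over the parameter window `[t₀, t₁]` of the lower arc
of `K` by an increasing diffeomorphism `σ` which near the two ends of the window *matches a
coordinate*: `g' (σ t) = g t`, where `g`, `g'` are the planar `x₁`-coordinates of the two knots in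
a thickening of the band (both with positive derivative at the incoming end and negative derivative
at the outgoing end). Everything here is proved; no named facts are introduced.

* `exists_matchingGerm` — for `C^∞` germs `g` at `a`, `g'` at `a'` with `g' a' = g a` and positive
  derivatives there is an increasing `C^∞` germ `τ` at `a` with `τ a = a'` and `g' ∘ τ = g`
  (`τ = g'⁻¹ ∘ g`, inverse function theorem in one variable); `exists_matchingGerm_of_neg` — the
  same for negative derivatives.
* `exists_matchingGlue` — two increasing `C^∞` germs `τA` at `t₀` and `τB` at `t₁` (`t₀ < t₁`) with
  `τA t₀ < τB t₁` are the restrictions of one function `σ`, `C^∞` with positive derivative on a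
  neighbourhood of `[t₀, t₁]` (glue through an affine function in the middle by smooth steps, the
  corrections having the right signs).

## References

* M. W. Hirsch, *Differential Topology* (1976), Ch. 8 §1 (reparametrisation of isotopies); the
  statements are folklore calculus. [HirschDT1976]

## Design notes

* Smoothness is expressed pointwise (`ContDiffAt` on open intervals) since the germs are only
  defined near their base points. Nothing here uses `sorry`.
-/

open Function Set Metric Filter
open scoped ContDiff Topology

noncomputable section

namespace Literature.Topology.FourManifolds

/-! ## Matching germs -/

/-- **Matching germ** (inverse function theorem in one variable). If `g` is `C^∞` near `a`, `g'` is
`C^∞` near `a'`, `g' a' = g a`, and both derivatives are positive at these points, then there is a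
function `τ` with `τ a = a'`, `C^∞`, strictly increasing and with positive derivative on an
interval `(a - κ, a + κ)` (`κ ≤ κ₀`), such that `g' (τ t) = g t` there and `τ` maps that interval into
`(a' - κ₀', a' + κ₀')`. [folklore] -/
theorem exists_matchingGerm {g g' : ℝ → ℝ} {a a' κ₀ κ₀' : ℝ} (hκ₀ : 0 < κ₀) (hκ₀' : 0 < κ₀')
    (hg : ∀ t ∈ Ioo (a - κ₀) (a + κ₀), ContDiffAt ℝ ∞ g t)
    (hg' : ∀ t ∈ Ioo (a' - κ₀') (a' + κ₀'), ContDiffAt ℝ ∞ g' t)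
    (hga : 0 < deriv g a) (hga' : 0 < deriv g' a') (heq : g' a' = g a) :
    ∃ κ ∈ Ioc 0 κ₀, ∃ τ : ℝ → ℝ, τ a = a' ∧ StrictMonoOn τ (Ioo (a - κ) (a + κ)) ∧
      ∀ t ∈ Ioo (a - κ) (a + κ), ContDiffAt ℝ ∞ τ t ∧ 0 < deriv τ t ∧ g' (τ t) = g t ∧
        τ t ∈ Ioo (a' - κ₀') (a' + κ₀') := by
  obtain ⟨κ', hκ', e, heg, hsrc, -, hpos', hsymm⟩ :=
    exists_openPartialHomeomorph_of_deriv_pos hκ₀' hg' hga'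
  have hga0 : ContDiffAt ℝ ∞ g a := hg a ⟨by linarith, by linarith⟩
  have ha' : a' ∈ e.source := by rw [hsrc]; exact ⟨by linarith [hκ'.1], by linarith [hκ'.1]⟩
  have hgat : g a ∈ e.target := by rw [← heq, ← heg]; exact e.map_source ha'
  -- `g t` stays in the target and `g` has positive derivative, near `a`
  obtain ⟨κ₁, hκ₁, hsub₁⟩ : ∃ κ₁ > 0, Ioo (a - κ₁) (a + κ₁) ⊆ g ⁻¹' e.target := by
    obtain ⟨r, hr, h⟩ := Metric.mem_nhds_iff.1
      (hga0.continuousAt.preimage_mem_nhds (e.open_target.mem_nhds hgat))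
    exact ⟨r, hr, by rwa [Real.ball_eq_Ioo] at h⟩
  obtain ⟨κ₂, hκ₂, hsub₂⟩ : ∃ κ₂ > 0, Ioo (a - κ₂) (a + κ₂) ⊆ {t | 0 < deriv g t} := by
    obtain ⟨r, hr, h⟩ := Metric.mem_nhds_iff.1 (eventually_deriv_pos hga0 hga)
    exact ⟨r, hr, by rwa [Real.ball_eq_Ioo] at h⟩
  set κ : ℝ := min κ₀ (min κ₁ κ₂) with hκ
  have hκpos : 0 < κ := lt_min hκ₀ (lt_min hκ₁ hκ₂)
  have hI₀ : Ioo (a - κ) (a + κ) ⊆ Ioo (a - κ₀) (a + κ₀) :=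
    Ioo_subset_Ioo (by linarith [min_le_left κ₀ (min κ₁ κ₂)]) (by linarith [min_le_left κ₀ (min κ₁ κ₂)])
  have hI₁ : Ioo (a - κ) (a + κ) ⊆ Ioo (a - κ₁) (a + κ₁) :=
    Ioo_subset_Ioo (by linarith [min_le_right κ₀ (min κ₁ κ₂), min_le_left κ₁ κ₂])
      (by linarith [min_le_right κ₀ (min κ₁ κ₂), min_le_left κ₁ κ₂])
  have hI₂ : Ioo (a - κ) (a + κ) ⊆ Ioo (a - κ₂) (a + κ₂) :=
    Ioo_subset_Ioo (by linarith [min_le_right κ₀ (min κ₁ κ₂), min_le_right κ₁ κ₂])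
      (by linarith [min_le_right κ₀ (min κ₁ κ₂), min_le_right κ₁ κ₂])
  set τ : ℝ → ℝ := fun t ↦ e.symm (g t) with hτ
  -- pointwise properties
  have key : ∀ t ∈ Ioo (a - κ) (a + κ), ContDiffAt ℝ ∞ τ t ∧ 0 < deriv τ t ∧ g' (τ t) = g t ∧
      τ t ∈ Ioo (a' - κ₀') (a' + κ₀') := by
    intro t ht
    have hgt : g t ∈ e.target := hsub₁ (hI₁ ht)
    have hτs : τ t ∈ e.source := e.map_target hgt
    have hτs' : τ t ∈ Ioo (a' - κ') (a' + κ') := by rw [← hsrc]; exact hτs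
    have hτ₀ : τ t ∈ Ioo (a' - κ₀') (a' + κ₀') :=
      Ioo_subset_Ioo (by linarith [hκ'.2]) (by linarith [hκ'.2]) hτs'
    have hgc : ContDiffAt ℝ ∞ g t := hg t (hI₀ ht)
    have hsc : ContDiffAt ℝ ∞ e.symm (g t) := hsymm _ hgt
    have hright : g' (τ t) = g t := by
      show g' (e.symm (g t)) = g t
      rw [← heg]; exact e.right_inv hgt
    -- derivative of the inverse
    have hg'd : HasDerivAt g' (deriv g' (τ t)) (τ t) :=
      ((hg' _ hτ₀).differentiableAt (by simp)).hasDerivAt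
    have hg'd' : HasDerivAt e (deriv g' (τ t)) (e.symm (g t)) := by rw [heg]; exact hg'd
    have hinv : HasDerivAt e.symm (deriv g' (τ t))⁻¹ (g t) :=
      e.hasDerivAt_symm hgt (hpos' _ hτs').ne' hg'd'
    have hgd : HasDerivAt g (deriv g t) t := (hgc.differentiableAt (by simp)).hasDerivAt
    have hτd : HasDerivAt τ ((deriv g' (τ t))⁻¹ * deriv g t) t := hinv.comp t hgd
    refine ⟨hsc.comp t hgc, ?_, hright, hτ₀⟩
    rw [hτd.deriv]
    exact mul_pos (inv_pos.2 (hpos' _ hτs')) (hsub₂ (hI₂ ht))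
  refine ⟨κ, ⟨hκpos, min_le_left _ _⟩, τ, ?_, ?_, key⟩
  · show e.symm (g a) = a'
    rw [← heq, ← heg]; exact e.left_inv ha'
  · exact strictMonoOn_of_deriv_pos (convex_Ioo _ _)
      (fun t ht ↦ (key t ht).1.continuousAt.continuousWithinAt)
      (fun t ht ↦ (key t (interior_subset ht)).2.1)

/-- **Matching germ, decreasing coordinates**: as `exists_matchingGerm`, for negative derivatives of
`g` at `a` and of `g'` at `a'` (apply it to `-g`, `-g'`). [folklore] -/
theorem exists_matchingGerm_of_neg {g g' : ℝ → ℝ} {a a' κ₀ κ₀' : ℝ} (hκ₀ : 0 < κ₀) (hκ₀' : 0 < κ₀')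
    (hg : ∀ t ∈ Ioo (a - κ₀) (a + κ₀), ContDiffAt ℝ ∞ g t)
    (hg' : ∀ t ∈ Ioo (a' - κ₀') (a' + κ₀'), ContDiffAt ℝ ∞ g' t)
    (hga : deriv g a < 0) (hga' : deriv g' a' < 0) (heq : g' a' = g a) :
    ∃ κ ∈ Ioc 0 κ₀, ∃ τ : ℝ → ℝ, τ a = a' ∧ StrictMonoOn τ (Ioo (a - κ) (a + κ)) ∧
      ∀ t ∈ Ioo (a - κ) (a + κ), ContDiffAt ℝ ∞ τ t ∧ 0 < deriv τ t ∧ g' (τ t) = g t ∧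
        τ t ∈ Ioo (a' - κ₀') (a' + κ₀') := by
  have hn : ∀ (f : ℝ → ℝ) (t : ℝ), deriv (fun s ↦ -f s) t = -deriv f t := fun f t ↦ deriv.neg
  obtain ⟨κ, hκ, τ, hτa, hmono, key⟩ := exists_matchingGerm (g := fun s ↦ -g s) (g' := fun s ↦ -g' s)
    hκ₀ hκ₀' (fun t ht ↦ (hg t ht).neg) (fun t ht ↦ (hg' t ht).neg)
    (by rw [hn]; linarith) (by rw [hn]; linarith) (by rw [heq])
  exact ⟨κ, hκ, τ, hτa, hmono, fun t ht ↦
    let ⟨h1, h2, h3, h4⟩ := key t ht; ⟨h1, h2, neg_injective h3, h4⟩⟩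

/-! ## Gluing two germs into an increasing function over the window -/

section Glue

/-- The smooth step rising from `0` at `p` to `1` at `p + η`. [folklore] -/
def glueStep (p η : ℝ) (t : ℝ) : ℝ := Real.smoothTransition ((t - p) / η)

/-- The smooth step is smooth. [folklore] -/
theorem contDiff_glueStep (p η : ℝ) : ContDiff ℝ ∞ (glueStep p η) :=
  Real.smoothTransition.contDiff.comp ((contDiff_id.sub contDiff_const).div_const _)

/-- The smooth step vanishes left of `p`. [folklore] -/
theorem glueStep_of_le {p η t : ℝ} (hη : 0 < η) (ht : t ≤ p) : glueStep p η t = 0 :=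
  Real.smoothTransition.zero_of_nonpos (div_nonpos_of_nonpos_of_nonneg (by linarith) hη.le)

/-- The smooth step is `1` right of `p + η`. [folklore] -/
theorem glueStep_of_ge {p η t : ℝ} (hη : 0 < η) (ht : p + η ≤ t) : glueStep p η t = 1 :=
  Real.smoothTransition.one_of_one_le (by rw [le_div_iff₀ hη]; linarith)

/-- The smooth step takes values in `[0, 1]`. [folklore] -/
theorem glueStep_mem_Icc (p η t : ℝ) : glueStep p η t ∈ Icc (0 : ℝ) 1 :=
  ⟨Real.smoothTransition.nonneg _, Real.smoothTransition.le_one _⟩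

/-- The smooth step is monotone. [folklore] -/
theorem monotone_glueStep {p η : ℝ} (hη : 0 < η) : Monotone (glueStep p η) := fun _ _ hst ↦
  Real.smoothTransition.monotone (div_le_div_of_nonneg_right (by linarith) hη.le)

/-- The smooth step has nonnegative derivative. [folklore] -/
theorem deriv_glueStep_nonneg {p η : ℝ} (hη : 0 < η) (t : ℝ) : 0 ≤ deriv (glueStep p η) t :=
  (monotone_glueStep hη).deriv_nonneg

/-- The smooth step is eventually `0` left of `p`. [folklore] -/
theorem glueStep_eventuallyEq_zero {p η t : ℝ} (hη : 0 < η) (ht : t < p) :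
    glueStep p η =ᶠ[𝓝 t] fun _ ↦ 0 := by
  filter_upwards [Iio_mem_nhds ht] with s hs using glueStep_of_le hη (le_of_lt hs)

/-- The smooth step is eventually `1` right of `p + η`. [folklore] -/
theorem glueStep_eventuallyEq_one {p η t : ℝ} (hη : 0 < η) (ht : p + η < t) :
    glueStep p η =ᶠ[𝓝 t] fun _ ↦ 1 := by
  filter_upwards [Ioi_mem_nhds ht] with s hs using glueStep_of_ge hη (le_of_lt hs)

set_option maxHeartbeats 400000 in
/-- **Gluing two increasing germs over a window.** Let `t₀ < t₁`, and let `τA`, `τB` be `C^∞` with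
positive derivative (hence strictly increasing) on `(t₀ - κ, t₀ + κ)`, `(t₁ - κ, t₁ + κ)`, with
`τA t₀ < τB t₁`. Then for some `η ∈ (0, κ]` there is `σ : ℝ → ℝ`, `C^∞` with positive derivative and
strictly increasing on `(t₀ - η, t₁ + η)`, equal to `τA` on `(-∞, t₀ + η]` and to `τB` on
`[t₁ - η, ∞)`. Construction: `σ = (1 - ρ₁) τA + ρ₁ ((1 - ρ₂) ℓ + ρ₂ τB)` with smooth steps `ρ₁`
(rising on `[t₀ + η, t₀ + 2η]`), `ρ₂` (rising on `[t₁ - 2η, t₁ - η]`) and `ℓ` affine increasing with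
`τA < ℓ` on the first transition zone and `ℓ < τB` on the second, so that the correction terms
`ρ₁' (ℓ - τA)`, `ρ₂' (τB - ℓ)` in `σ'` are nonnegative. [folklore] -/
theorem exists_matchingGlue {τA τB : ℝ → ℝ} {t₀ t₁ κ : ℝ} (hκ : 0 < κ) (h01 : t₀ < t₁)
    (hAB : τA t₀ < τB t₁)
    (hA : ∀ t ∈ Ioo (t₀ - κ) (t₀ + κ), ContDiffAt ℝ ∞ τA t ∧ 0 < deriv τA t)
    (hB : ∀ t ∈ Ioo (t₁ - κ) (t₁ + κ), ContDiffAt ℝ ∞ τB t ∧ 0 < deriv τB t) :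
    ∃ η ∈ Ioc 0 κ, ∃ σ : ℝ → ℝ, (∀ t ∈ Ioo (t₀ - η) (t₁ + η), ContDiffAt ℝ ∞ σ t ∧ 0 < deriv σ t) ∧
      StrictMonoOn σ (Ioo (t₀ - η) (t₁ + η)) ∧ (∀ t ≤ t₀ + η, σ t = τA t) ∧ (∀ t ≥ t₁ - η, σ t = τB t) := by
  have hAm : StrictMonoOn τA (Ioo (t₀ - κ) (t₀ + κ)) := strictMonoOn_of_deriv_pos (convex_Ioo _ _)
    (fun t ht ↦ (hA t ht).1.continuousAt.continuousWithinAt) (fun t ht ↦ (hA t (interior_subset ht)).2)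
  have hBm : StrictMonoOn τB (Ioo (t₁ - κ) (t₁ + κ)) := strictMonoOn_of_deriv_pos (convex_Ioo _ _)
    (fun t ht ↦ (hB t ht).1.continuousAt.continuousWithinAt) (fun t ht ↦ (hB t (interior_subset ht)).2)
  -- continuity of the germs at the base points
  set gap : ℝ := (τB t₁ - τA t₀) / 3 with hgap
  have hgap0 : 0 < gap := by rw [hgap]; linarith
  have hcA : ContinuousAt τA t₀ := (hA t₀ ⟨by linarith, by linarith⟩).1.continuousAt
  have hcB : ContinuousAt τB t₁ := (hB t₁ ⟨by linarith, by linarith⟩).1.continuousAt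
  obtain ⟨dA, hdA, hdA'⟩ := Metric.continuousAt_iff.1 hcA gap hgap0
  obtain ⟨dB, hdB, hdB'⟩ := Metric.continuousAt_iff.1 hcB gap hgap0
  -- the margin
  set η : ℝ := min (min κ (t₁ - t₀)) (min dA dB) / 5 with hη
  have hm0 : 0 < min (min κ (t₁ - t₀)) (min dA dB) := lt_min (lt_min hκ (by linarith)) (lt_min hdA hdB)
  have hη0 : 0 < η := by rw [hη]; positivity
  have hηκ : 5 * η ≤ κ := by
    have : min (min κ (t₁ - t₀)) (min dA dB) ≤ κ := (min_le_left _ _).trans (min_le_left _ _)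
    rw [hη]; linarith
  have hη01 : 5 * η ≤ t₁ - t₀ := by
    have : min (min κ (t₁ - t₀)) (min dA dB) ≤ t₁ - t₀ := (min_le_left _ _).trans (min_le_right _ _)
    rw [hη]; linarith
  have hηA : 5 * η ≤ dA := by
    have : min (min κ (t₁ - t₀)) (min dA dB) ≤ dA := (min_le_right _ _).trans (min_le_left _ _)
    rw [hη]; linarith
  have hηB : 5 * η ≤ dB := by
    have : min (min κ (t₁ - t₀)) (min dA dB) ≤ dB := (min_le_right _ _).trans (min_le_right _ _)
    rw [hη]; linarith
  -- values of the germs at the ends of the transition zones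
  have hA2 : τA (t₀ + 2 * η) < τA t₀ + gap := by
    have hd : dist (t₀ + 2 * η) t₀ < dA := by
      rw [Real.dist_eq, show t₀ + 2 * η - t₀ = 2 * η by ring, abs_of_pos (by positivity)]
      linarith
    have := hdA' hd
    rw [Real.dist_eq] at this
    linarith [(abs_lt.1 this).2]
  have hB2 : τB t₁ - gap < τB (t₁ - 2 * η) := by
    have hd : dist (t₁ - 2 * η) t₁ < dB := by
      rw [Real.dist_eq, show t₁ - 2 * η - t₁ = -(2 * η) by ring, abs_neg, abs_of_pos (by positivity)]
      linarith
    have := hdB' hd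
    rw [Real.dist_eq] at this
    linarith [(abs_lt.1 this).1]
  -- the affine middle function
  set mA : ℝ := τA t₀ + gap with hmA
  set mB : ℝ := τB t₁ - gap with hmB
  have hmAB : mA < mB := by rw [hmA, hmB, hgap]; linarith
  set slope : ℝ := (mB - mA) / (t₁ - t₀ - 2 * η) with hslope
  have hden : 0 < t₁ - t₀ - 2 * η := by linarith
  have hslope0 : 0 < slope := div_pos (by linarith) hden
  set ℓ : ℝ → ℝ := fun t ↦ mA + (t - (t₀ + η)) * slope with hℓ
  have hℓA : ℓ (t₀ + η) = mA := by simp [hℓ]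
  have hℓB : ℓ (t₁ - η) = mB := by
    simp only [hℓ]
    rw [show t₁ - η - (t₀ + η) = t₁ - t₀ - 2 * η by ring, hslope, mul_div_cancel₀ _ hden.ne']
    ring
  have hℓmono : StrictMono ℓ := fun s t hst ↦ by
    simp only [hℓ]; nlinarith
  have hℓd : ∀ t, HasDerivAt ℓ slope t := fun t ↦ by
    have := ((hasDerivAt_id t).sub_const (t₀ + η)).mul_const slope
    simpa [hℓ] using this.const_add mA
  have hℓc : ContDiff ℝ ∞ ℓ := by
    simp only [hℓ]; exact contDiff_const.add ((contDiff_id.sub contDiff_const).mul contDiff_const)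
  -- the steps
  set ρ₁ : ℝ → ℝ := glueStep (t₀ + η) η with hρ₁
  set ρ₂ : ℝ → ℝ := glueStep (t₁ - 2 * η) η with hρ₂
  -- the glued function
  set σ : ℝ → ℝ := fun t ↦ (1 - ρ₁ t) * τA t + ρ₁ t * ((1 - ρ₂ t) * ℓ t + ρ₂ t * τB t) with hσ
  -- comparison on the transition zones
  have hℓτA : ∀ t ∈ Icc (t₀ + η) (t₀ + 2 * η), τA t ≤ ℓ t := by
    intro t ht
    have h1 : τA t ≤ τA (t₀ + 2 * η) := hAm.monotoneOn ⟨by linarith [ht.1], by linarith [ht.2]⟩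
      ⟨by linarith, by linarith⟩ ht.2
    have h2 : ℓ (t₀ + η) ≤ ℓ t := hℓmono.monotone ht.1
    linarith
  have hℓτB : ∀ t ∈ Icc (t₁ - 2 * η) (t₁ - η), ℓ t ≤ τB t := by
    intro t ht
    have h1 : τB (t₁ - 2 * η) ≤ τB t := hBm.monotoneOn ⟨by linarith, by linarith⟩
      ⟨by linarith [ht.1], by linarith [ht.2]⟩ ht.1
    have h2 : ℓ t ≤ ℓ (t₁ - η) := hℓmono.monotone ht.2
    linarith
  -- Region I: `t < min (t₀ + κ) (t₁ - 2η)`: `σ = (1 - ρ₁) τA + ρ₁ ℓ` near `t`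
  have regI : ∀ t ∈ Ioo (t₀ - κ) (min (t₀ + κ) (t₁ - 2 * η)), ContDiffAt ℝ ∞ σ t ∧ 0 < deriv σ t := by
    intro t ht
    have htκ : t ∈ Ioo (t₀ - κ) (t₀ + κ) := ⟨ht.1, lt_of_lt_of_le ht.2 (min_le_left _ _)⟩
    have ht2 : t < t₁ - 2 * η := lt_of_lt_of_le ht.2 (min_le_right _ _)
    obtain ⟨hτc, hτd⟩ := hA t htκ
    have hev : σ =ᶠ[𝓝 t] fun s ↦ (1 - ρ₁ s) * τA s + ρ₁ s * ℓ s := by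
      filter_upwards [glueStep_eventuallyEq_zero (p := t₁ - 2 * η) hη0 ht2] with s hs
      simp only [hσ, hρ₂] at hs ⊢
      rw [hs]; ring
    have hρ₁c : ContDiffAt ℝ ∞ ρ₁ t := (contDiff_glueStep _ _).contDiffAt
    have hF : ContDiffAt ℝ ∞ (fun s ↦ (1 - ρ₁ s) * τA s + ρ₁ s * ℓ s) t :=
      ((contDiffAt_const.sub hρ₁c).mul hτc).add (hρ₁c.mul hℓc.contDiffAt)
    refine ⟨hF.congr_of_eventuallyEq hev, ?_⟩
    rw [hev.deriv_eq]
    have hτAd : HasDerivAt τA (deriv τA t) t := (hτc.differentiableAt (by simp)).hasDerivAt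
    have hρd : HasDerivAt ρ₁ (deriv ρ₁ t) t := ((contDiff_glueStep _ _).differentiable (by simp) t).hasDerivAt
    have hD : HasDerivAt (fun s ↦ (1 - ρ₁ s) * τA s + ρ₁ s * ℓ s)
        ((0 - deriv ρ₁ t) * τA t + (1 - ρ₁ t) * deriv τA t + (deriv ρ₁ t * ℓ t + ρ₁ t * slope)) t :=
      (((hasDerivAt_const t (1 : ℝ)).sub hρd).mul hτAd).add (hρd.mul (hℓd t))
    rw [hD.deriv]
    have hρ01 : ρ₁ t ∈ Icc (0 : ℝ) 1 := glueStep_mem_Icc (t₀ + η) η t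
    have hρ' : 0 ≤ deriv ρ₁ t := deriv_glueStep_nonneg (p := t₀ + η) hη0 t
    -- the correction `ρ₁' (ℓ - τA)` is nonnegative
    have hcorr : 0 ≤ deriv ρ₁ t * (ℓ t - τA t) := by
      by_cases h1 : t < t₀ + η
      · rw [(glueStep_eventuallyEq_zero (p := t₀ + η) hη0 h1).deriv_eq]; simp
      by_cases h2 : t₀ + 2 * η < t
      · have : t₀ + η + η < t := by linarith
        rw [(glueStep_eventuallyEq_one (p := t₀ + η) hη0 this).deriv_eq]; simp
      push Not at h1 h2
      exact mul_nonneg hρ' (sub_nonneg.2 (hℓτA t ⟨h1, h2⟩))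
    have hmain : 0 < (1 - ρ₁ t) * deriv τA t + ρ₁ t * slope := by
      rcases hρ01.2.eq_or_lt with h | h
      · rw [h]; simpa using hslope0
      · have : 0 ≤ ρ₁ t * slope := mul_nonneg hρ01.1 hslope0.le
        nlinarith
    nlinarith
  -- Region II: `t₀ + 2η < t < t₁ - 2η`: `σ = ℓ` near `t`
  have regII : ∀ t ∈ Ioo (t₀ + 2 * η) (t₁ - 2 * η), ContDiffAt ℝ ∞ σ t ∧ 0 < deriv σ t := by
    intro t ht
    have hev : σ =ᶠ[𝓝 t] ℓ := by
      filter_upwards [glueStep_eventuallyEq_one (p := t₀ + η) hη0 (show t₀ + η + η < t by linarith [ht.1]),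
        glueStep_eventuallyEq_zero (p := t₁ - 2 * η) hη0 ht.2] with s hs1 hs2
      simp only [hσ, hρ₁, hρ₂] at hs1 hs2 ⊢
      rw [hs1, hs2]; ring
    refine ⟨hℓc.contDiffAt.congr_of_eventuallyEq hev, ?_⟩
    rw [hev.deriv_eq, (hℓd t).deriv]; exact hslope0
  -- Region III: `max (t₁ - κ) (t₀ + 2η) < t < t₁ + κ`: `σ = (1 - ρ₂) ℓ + ρ₂ τB` near `t`
  have regIII : ∀ t ∈ Ioo (max (t₁ - κ) (t₀ + 2 * η)) (t₁ + κ), ContDiffAt ℝ ∞ σ t ∧ 0 < deriv σ t := by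
    intro t ht
    have htκ : t ∈ Ioo (t₁ - κ) (t₁ + κ) := ⟨lt_of_le_of_lt (le_max_left _ _) ht.1, ht.2⟩
    have ht2 : t₀ + 2 * η < t := lt_of_le_of_lt (le_max_right _ _) ht.1
    obtain ⟨hτc, hτd⟩ := hB t htκ
    have hev : σ =ᶠ[𝓝 t] fun s ↦ (1 - ρ₂ s) * ℓ s + ρ₂ s * τB s := by
      filter_upwards [glueStep_eventuallyEq_one (p := t₀ + η) hη0 (show t₀ + η + η < t by linarith)] with s hs
      simp only [hσ, hρ₁] at hs ⊢
      rw [hs]; ring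
    have hρ₂c : ContDiffAt ℝ ∞ ρ₂ t := (contDiff_glueStep _ _).contDiffAt
    have hF : ContDiffAt ℝ ∞ (fun s ↦ (1 - ρ₂ s) * ℓ s + ρ₂ s * τB s) t :=
      ((contDiffAt_const.sub hρ₂c).mul hℓc.contDiffAt).add (hρ₂c.mul hτc)
    refine ⟨hF.congr_of_eventuallyEq hev, ?_⟩
    rw [hev.deriv_eq]
    have hτBd : HasDerivAt τB (deriv τB t) t := (hτc.differentiableAt (by simp)).hasDerivAt
    have hρd : HasDerivAt ρ₂ (deriv ρ₂ t) t := ((contDiff_glueStep _ _).differentiable (by simp) t).hasDerivAt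
    have hD : HasDerivAt (fun s ↦ (1 - ρ₂ s) * ℓ s + ρ₂ s * τB s)
        ((0 - deriv ρ₂ t) * ℓ t + (1 - ρ₂ t) * slope + (deriv ρ₂ t * τB t + ρ₂ t * deriv τB t)) t :=
      (((hasDerivAt_const t (1 : ℝ)).sub hρd).mul (hℓd t)).add (hρd.mul hτBd)
    rw [hD.deriv]
    have hρ01 : ρ₂ t ∈ Icc (0 : ℝ) 1 := glueStep_mem_Icc (t₁ - 2 * η) η t
    have hρ' : 0 ≤ deriv ρ₂ t := deriv_glueStep_nonneg (p := t₁ - 2 * η) hη0 t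
    have hcorr : 0 ≤ deriv ρ₂ t * (τB t - ℓ t) := by
      by_cases h1 : t < t₁ - 2 * η
      · rw [(glueStep_eventuallyEq_zero (p := t₁ - 2 * η) hη0 h1).deriv_eq]; simp
      by_cases h2 : t₁ - η < t
      · have : t₁ - 2 * η + η < t := by linarith
        rw [(glueStep_eventuallyEq_one (p := t₁ - 2 * η) hη0 this).deriv_eq]; simp
      push Not at h1 h2
      exact mul_nonneg hρ' (sub_nonneg.2 (hℓτB t ⟨h1, h2⟩))
    have hmain : 0 < (1 - ρ₂ t) * slope + ρ₂ t * deriv τB t := by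
      rcases hρ01.2.eq_or_lt with h | h
      · rw [h]; simpa using hτd
      · have : 0 ≤ ρ₂ t * deriv τB t := mul_nonneg hρ01.1 hτd.le
        nlinarith
    nlinarith
  -- assemble
  have hall : ∀ t ∈ Ioo (t₀ - η) (t₁ + η), ContDiffAt ℝ ∞ σ t ∧ 0 < deriv σ t := by
    intro t ht
    by_cases h1 : t < min (t₀ + κ) (t₁ - 2 * η)
    · exact regI t ⟨by linarith [ht.1], h1⟩
    by_cases h2 : t < t₁ - 2 * η
    · refine regII t ⟨?_, h2⟩
      push Not at h1
      have : min (t₀ + κ) (t₁ - 2 * η) = t₀ + κ := min_eq_left_iff.2 (by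
        by_contra hcon; push Not at hcon
        rw [min_eq_right hcon.le] at h1; linarith)
      rw [this] at h1; linarith
    · push Not at h2
      refine regIII t ⟨max_lt (by linarith) (by linarith), by linarith [ht.2]⟩
  refine ⟨η, ⟨hη0, by linarith⟩, σ, hall, ?_, ?_, ?_⟩
  · exact strictMonoOn_of_deriv_pos (convex_Ioo _ _)
      (fun t ht ↦ (hall t ht).1.continuousAt.continuousWithinAt)
      (fun t ht ↦ (hall t (interior_subset ht)).2)
  · intro t ht
    simp only [hσ, hρ₁]
    rw [glueStep_of_le hη0 ht]; ring
  · intro t ht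
    simp only [hσ, hρ₁, hρ₂]
    rw [glueStep_of_ge hη0 (by linarith), glueStep_of_ge hη0 (by linarith)]; ring

end Glue

end Literature.Topology.FourManifolds
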